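import Summits.Ventures.GridStability.Models.StructurePreservingLurieLevel
import Literature.MathematicalPhysics.PowerSystems.LuriePostnikovSlabCertificate

/-!
# GridStability/Models/StructurePreservingSlab — lit-6's Lur'e–Postnikov SLAB certificate (S-procedure
# + POPOV integral terms) transported to solutions of the structure-preserving model MV-3: the
# receptacle the SP–Lur'e lane needs at printed-class damping

LADDER-GRIDFUSION G2 «SP–Lur'e lane» / G3 register, seat gridfusion-model-2 (g6). Written for the
lead's R-G2-WAVE1 (a) (2026-08-27T05:00:34Z): sos-4 measures the Popov-FREE Vu–Turitsyn shape
(`QuadraticCertificate`, receptacles `NE39SP/WSCC9SP.lurie_roa_of_eps`) infeasible on every lightly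
damped benchmark object, while the POPOV tier passes — so the SP-lane producer target is a
`SlabCertificate` [cite: Pai1981, §2.16 Theorem [18] eqs. (2.63)–(2.64)] on model-2's reference-relative
object `Params.relLurie` (p491127). THIS FILE is that receptacle, generic in the instance:
* `posSemidef_smul_sub_vecMulVec_of_coercive` — bare-matrix twin of p496574's rank-one lemma
  (`P − ε·1 ⪰ 0`, `cᵀc ≤ s·ε ⇒ s·P − ccᵀ ⪰ 0`), and `relLurie_slab_rankOne_of_eps`: for a slab
  certificate on `relLurie`, `(2/ε)·P − C_eᵀC_e ⪰ 0` on every listed line (rows have `C_eᵀC_e ≤ 2`);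
* `mem_slab_relState_iff` — `relState(δ, ω)` lies in the open slab `γ` iff every listed line-angle
  DEVIATION satisfies `|σ_e − σ*_e| < γ_e`;
* `relLurie_slab_sector_of_window` — the per-channel sector hypothesis `hsec` of lit-6's theorem from the
  typed WINDOW `|σ*_e| ≤ θ`: relLurie channels are SIN channels, so for a uniform half-width `γ ≥ 0`
  with `θ + γ ≤ π`, any slopes `a_e ≤ cos(θ + γ)`, `b_e ≥ 1` do [`channel_sector_sin`];
* `relLurie_lt_V_frontier_slab_of_eps` — the ε-LEVEL `2c < ε·γ_e²` lies below `V` on the slab faces;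
* `tendsto_relState_of_slabCertificate` (+ `_shifted`, + `tendsto_of_isSolution_of_slabCertificate`) —
  lit-6's `SlabCertificate.well_subset_regionOfAttraction` carried to phase solutions of MV-3 by the
  bridge `hasDerivWithinAt_relState` (p493032): NO observability hypothesis (the decay rate `η > 0`
  does it), but the reference-relative object is still required — in absolute SP coordinates the
  rotation `𝟙` lies in `ker A`, so `AᵀP + PA + η·1 ⪯ …` has no solution and every slab LMI is
  infeasible; conclusions reference-free (`tendsto_of_tendsto_relState`).
NOTE FOR PRODUCERS: `relLurie` has `C·B ≠ 0` (the load-bus rows `inc_e(v)/D_v` and the reference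
row `−inc_e(r)/D_r` of `B` sit in the angle block that `C` reads); lit-6's `slabL22 =
−diag(lam)·CB − (diag(lam)·CB)ᵀ − diag τ` carries exactly these terms.
THREE COLUMNS: MODELLED column only (typing); no certificate is produced or assumed to exist here;
nothing says a grid is stable. MODELLED: absent effects = MODEL-VALIDITY MV-3; reference bus =
bookkeeping.
-/

noncomputable section

open Finset Real Set Filter Matrix
open scoped Topology
open Literature.MathematicalPhysics.PowerSystems
open Literature.MathematicalPhysics.PowerSystems.LyapunovFunctionFamily

namespace Summit.Ventures.GridStability.Models.StructurePreserving

/-! ## Rank-one facts from a bare coercivity fact -/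

section RankOne

variable {ι κ : Type*} [Fintype ι] [Fintype κ] [DecidableEq ι] [DecidableEq κ]

/-- **Rank-one facts from coercivity, bare-matrix form**: `Pᵀ = P`, `P − ε·1 ⪰ 0`, `ε > 0` and
`cᵀc ≤ s·ε` give `s·P − ccᵀ ⪰ 0` (Cauchy–Schwarz). Twin of p496574's
`posSemidef_smul_sub_vecMulVec_of_le` usable with ANY certificate structure carrying these fields.
[cite: VuTuritsyn2017, §4.3 eq. (V_min)] -/
theorem posSemidef_smul_sub_vecMulVec_of_coercive {P : Matrix ι ι ℝ} (hPt : Pᵀ = P) {ε : ℝ}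
    (hε : 0 < ε) (hP : (P - ε • (1 : Matrix ι ι ℝ)).PosSemidef) {s : ℝ} {c : ι → ℝ}
    (h : c ⬝ᵥ c ≤ s * ε) : (s • P - Matrix.vecMulVec c c).PosSemidef := by
  have hcc : 0 ≤ c ⬝ᵥ c := by
    simp only [dotProduct]
    exact Finset.sum_nonneg fun i _ => mul_self_nonneg (c i)
  have hs : 0 ≤ s := le_of_mul_le_mul_right (by rw [zero_mul]; exact hcc.trans h) hε
  refine Matrix.PosSemidef.of_dotProduct_mulVec_nonneg ?_ fun x => ?_
  · show (s • P - Matrix.vecMulVec c c)ᴴ = s • P - Matrix.vecMulVec c c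
    rw [Matrix.conjTranspose_eq_transpose_of_trivial, Matrix.transpose_sub, Matrix.transpose_smul,
      hPt, Matrix.transpose_vecMulVec]
  · have hV : ε * (x ⬝ᵥ x) ≤ x ⬝ᵥ (P *ᵥ x) := by
      have h0 := hP.dotProduct_mulVec_nonneg x
      rw [star_trivial, Matrix.sub_mulVec, Matrix.smul_mulVec, Matrix.one_mulVec, dotProduct_sub,
        dotProduct_smul, smul_eq_mul] at h0
      linarith
    have hxx : 0 ≤ x ⬝ᵥ x := by
      simp only [dotProduct]
      exact Finset.sum_nonneg fun i _ => mul_self_nonneg (x i)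
    have hq : x ⬝ᵥ (Matrix.vecMulVec c c *ᵥ x) = (c ⬝ᵥ x) ^ 2 := by
      have hr : Matrix.vecMulVec c c *ᵥ x = fun i => c i * (c ⬝ᵥ x) := by
        funext i
        simp [Matrix.mulVec, dotProduct, Matrix.vecMulVec, Finset.mul_sum, mul_assoc]
      rw [hr]
      have e1 : (x ⬝ᵥ fun i => c i * (c ⬝ᵥ x)) = (∑ i, x i * c i) * (c ⬝ᵥ x) := by
        simp only [dotProduct, Finset.sum_mul]
        refine Finset.sum_congr rfl fun i _ => ?_
        ring
      rw [e1, sq]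
      congr 1
      simp only [dotProduct]
      refine Finset.sum_congr rfl fun i _ => ?_
      ring
    have hcs : (c ⬝ᵥ x) ^ 2 ≤ (c ⬝ᵥ c) * (x ⬝ᵥ x) := by
      have h' := Finset.sum_mul_sq_le_sq_mul_sq Finset.univ c x
      simpa only [dotProduct, sq] using h'
    have h1 : s * (ε * (x ⬝ᵥ x)) ≤ s * (x ⬝ᵥ (P *ᵥ x)) := mul_le_mul_of_nonneg_left hV hs
    have h2 : (c ⬝ᵥ c) * (x ⬝ᵥ x) ≤ s * ε * (x ⬝ᵥ x) := mul_le_mul_of_nonneg_right h hxx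
    rw [star_trivial, Matrix.sub_mulVec, Matrix.smul_mulVec, dotProduct_sub, dotProduct_smul,
      smul_eq_mul, hq]
    nlinarith [h1, h2, hcs]

/-- For a SLAB certificate: the uniform constant `s = K/ε` works for every row `c` with `cᵀc ≤ K`.
[cite: Pai1981, §2.16 eq. (2.63); VuTuritsyn2017, §4.3 eq. (V_min)] -/
theorem slab_rankOne_of_le {S : System ι κ} (Λ : SlabCertificate S) {K : ℝ} {c : ι → ℝ}
    (h : c ⬝ᵥ c ≤ K) : ((K / Λ.ε) • Λ.P - Matrix.vecMulVec c c).PosSemidef :=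
  posSemidef_smul_sub_vecMulVec_of_coercive Λ.P_symm Λ.ε_pos Λ.P_ge
    (by rwa [div_mul_cancel₀ K Λ.ε_pos.ne'])

end RankOne

namespace Params

variable {k g m : ℕ} (p : Params (k + 1)) (r : Fin (k + 1)) (gnode : Fin g → Fin (k + 1))
  (src tgt : Fin m → Fin (k + 1)) (wt : Fin m → ℝ) (δs : Fin (k + 1) → ℝ)

/-! ## The slab in MV-3 terms and the rank-one facts of the relative object -/

/-- **The slab in MV-3 terms**: `relState(δ, ω)` lies in the open slab `γ` iff every LISTED
line-angle deviation satisfies `|(δ_{src e} − δ_{tgt e}) − (δ*_{src e} − δ*_{tgt e})| < γ_e`.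
[cite: Pai1981, §4.6 p. 117 (sector region of σ); VuTuritsyn2017, §4.1] -/
theorem mem_slab_relState_iff (γ : Fin m → ℝ) (z : (Fin (k + 1) → ℝ) × (Fin (k + 1) → ℝ)) :
    relState r gnode δs z ∈ (p.relLurie r gnode src tgt wt δs).slab γ
      ↔ ∀ e, |(z.1 (src e) - z.1 (tgt e)) - (δs (src e) - δs (tgt e))| < γ e := by
  simp only [LyapunovFunctionFamily.System.slab, Set.mem_setOf_eq, relLurie_C_mulVec_relState]

/-- **Rank-one facts for a slab certificate on the relative object from `ε` alone**:
`(2/ε)·P − C_eᵀC_e ⪰ 0` on every listed line. [cite: VuTuritsyn2017, §4.3 eq. (V_min)] -/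
theorem relLurie_slab_rankOne_of_eps (Λ : SlabCertificate (p.relLurie r gnode src tgt wt δs))
    (e : Fin m) :
    ((2 / Λ.ε) • Λ.P - Matrix.vecMulVec ((p.relLurie r gnode src tgt wt δs).C e)
      ((p.relLurie r gnode src tgt wt δs).C e)).PosSemidef :=
  slab_rankOne_of_le Λ (relLurie_C_dotProduct_self_le_two p r gnode src tgt wt δs e)

variable {p r gnode src tgt wt δs}

/-- **The per-channel sector hypothesis from the window.** The channels of the relative object are
SIN channels `F_e = sin(σ*_e + y) − sin σ*_e` with `|σ*_e| ≤ θ`; for a slab half-width `γ ≥ 0` with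
`θ + γ ≤ π`, slopes `a_e ≤ cos(θ + γ)` and `b_e ≥ 1` satisfy lit-6's `hsec` on `|ξ − σ*_e| ≤ γ`.
(For a channel carrying a Popov coefficient the certificate itself needs `a_e ≥ 0`, i.e. in practice
`θ + γ ≤ π/2`.) [cite: Pai1981, §4.6 p. 117; VuTuritsyn2017, §4.1 eq. (bound)] -/
theorem relLurie_slab_sector_of_window (Λ : SlabCertificate (p.relLurie r gnode src tgt wt δs))
    {θ γ : ℝ} (hγ : 0 ≤ γ) (hθγ : θ + γ ≤ π) (hwin : ∀ e, |δs (src e) - δs (tgt e)| ≤ θ)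
    (ha : ∀ e, Λ.a e ≤ Real.cos (θ + γ)) (hb : ∀ e, 1 ≤ Λ.b e) :
    ∀ e ξ, |ξ - (p.relLurie r gnode src tgt wt δs).δs e| ≤ γ →
      Λ.a e ≤ Real.cos ξ ∧ Real.cos ξ ≤ Λ.b e := by
  intro e ξ hξ
  rw [relLurie_δs] at hξ
  have hw := hwin e
  have h0 : 0 ≤ |δs (src e) - δs (tgt e)| + γ := by positivity
  have hπe : |δs (src e) - δs (tgt e)| + γ ≤ π := by linarith
  have hae : Λ.a e ≤ Real.cos (|δs (src e) - δs (tgt e)| + γ) :=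
    (ha e).trans (Real.cos_le_cos_of_nonneg_of_le_pi h0 hθγ (by linarith))
  exact channel_sector_sin hπe hae (hb e) ξ hξ

/-- **The ε-level for a slab certificate on the relative object**: every `c` with `2c < ε·γ_e²` on
every listed line lies below `V` on the frontier of the slab (lit-6's `lt_V_of_mem_frontier_slab`
with `s_e := 2/ε`). [cite: VuTuritsyn2017, §4.3 eq. (V_min); Pai1981, §2.16 eq. (2.63)] -/
theorem relLurie_lt_V_frontier_slab_of_eps (Λ : SlabCertificate (p.relLurie r gnode src tgt wt δs))
    {γ : Fin m → ℝ}
    (hsec : ∀ e ξ, |ξ - (p.relLurie r gnode src tgt wt δs).δs e| ≤ γ e →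
      Λ.a e ≤ Real.cos ξ ∧ Real.cos ξ ≤ Λ.b e)
    {c : ℝ} (hc : ∀ e, 2 * c < Λ.ε * γ e ^ 2) :
    ∀ x ∈ frontier ((p.relLurie r gnode src tgt wt δs).slab γ), c < Λ.V x := by
  intro x hx
  refine Λ.lt_V_of_mem_frontier_slab hsec (s := fun _ => 2 / Λ.ε)
    (fun _ => div_pos two_pos Λ.ε_pos)
    (fun e => relLurie_slab_rankOne_of_eps p r gnode src tgt wt δs Λ e) (fun e => ?_) hx
  rw [lt_div_iff₀ (div_pos two_pos Λ.ε_pos)]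
  have hε := Λ.ε_pos
  have key : c * (2 / Λ.ε) * Λ.ε < γ e ^ 2 * Λ.ε := by
    have hrw : c * (2 / Λ.ε) * Λ.ε = 2 * c := by field_simp
    rw [hrw]; linarith [hc e]
  exact lt_of_mul_lt_mul_right key hε.le

/-! ## The slab certificate transported to solutions of MV-3 -/

/-- **Lur'e–Postnikov slab certificate for MV-3 (phase solutions, frame `P⁰ = f(δ*)`).** Data: well
formed, reference load bus `r ∉ gen`, injective enumeration of `gen`, edge-list couplings, and an exact
`Λ : SlabCertificate` on the relative object whose channel sectors hold on the slab `γ` (`hsec`,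
e.g. `relLurie_slab_sector_of_window`) with a level `c < V` on the slab faces (`hfr`, e.g.
`relLurie_lt_V_frontier_slab_of_eps`). Conclusion: every phase solution `X` of `p.phaseField` whose
initial listed line-angle deviations satisfy `|σ_e(0) − σ*_e| < γ_e` and with `V(relState(X 0)) ≤ c`
keeps both for all `t ≥ 0`, and its relative state tends to `0`. NO observability hypothesis
(`V̇ ≤ −η|x|²`). CERTIFIED given `Λ`; MODEL MV-3; inner estimate.
[cite: Pai1981, §2.16 Theorem [18] and §4.6–§4.7; VuTuritsyn2017, §4.3 Theorem 1] -/
theorem tendsto_relState_of_slabCertificate (hp : p.WellFormed) (hr : r ∉ p.gen)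
    (hginj : Function.Injective gnode) (hgen : ∀ v, v ∈ p.gen ↔ ∃ j, gnode j = v)
    (hb : p.b = symmetrize (edgeWeight src tgt wt)) (hP : ∀ v, p.pe δs v = p.P0 v)
    (Λ : SlabCertificate (p.relLurie r gnode src tgt wt δs)) {γ : Fin m → ℝ}
    (hsec : ∀ e ξ, |ξ - (p.relLurie r gnode src tgt wt δs).δs e| ≤ γ e →
      Λ.a e ≤ Real.cos ξ ∧ Real.cos ξ ≤ Λ.b e)
    {c : ℝ} (hfr : ∀ x ∈ frontier ((p.relLurie r gnode src tgt wt δs).slab γ), c < Λ.V x)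
    {X : ℝ → (Fin (k + 1) → ℝ) × (Fin (k + 1) → ℝ)}
    (hX : ∀ T : ℝ, ∀ t ∈ Icc 0 T, HasDerivWithinAt X (p.phaseField (X t)) (Icc 0 T) t)
    (h0 : ∀ e, |((X 0).1 (src e) - (X 0).1 (tgt e)) - (δs (src e) - δs (tgt e))| < γ e)
    (hc : Λ.V (relState r gnode δs (X 0)) ≤ c) :
    (∀ t, 0 ≤ t →
        (∀ e, |((X t).1 (src e) - (X t).1 (tgt e)) - (δs (src e) - δs (tgt e))| < γ e) ∧
        Λ.V (relState r gnode δs (X t)) ≤ c) ∧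
      Tendsto (fun t => relState r gnode δs (X t)) atTop (𝓝 0) := by
  have hy : relState r gnode δs (X 0) ∈ (p.relLurie r gnode src tgt wt δs).slab γ :=
    (mem_slab_relState_iff p r gnode src tgt wt δs γ (X 0)).2 h0
  have hrel : ∀ T : ℝ, ∀ t ∈ Icc 0 T, HasDerivWithinAt (fun τ => relState r gnode δs (X τ))
      ((p.relLurie r gnode src tgt wt δs).field (relState r gnode δs (X t))) (Icc 0 T) t :=
    fun T t ht => hasDerivWithinAt_relState hp hr hginj hgen hb hP (hX T t ht)
  obtain ⟨-, hall⟩ := Λ.well_subset_regionOfAttraction hsec hfr hy hc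
  obtain ⟨hstay, hlim⟩ := hall (fun τ => relState r gnode δs (X τ)) rfl hrel
  refine ⟨fun t ht => ⟨?_, (hstay t ht).2⟩, hlim⟩
  exact (mem_slab_relState_iff p r gnode src tgt wt δs γ (X t)).1 (hstay t ht).1

/-- **The same in the frame rotating at the synchronous frequency** (`p.shifted.phaseField`, the
Lyapunov seat's `phaseField p`), for a synchronous equilibrium `δ*` of `p` (`f(δ*) = P̄`
[cite: Padiyar2013, §3.2 eqs (3.3)–(3.5)]); the certificate is for `p.relLurie …` itself
(`shifted_relLurie`). [cite: Pai1981, §2.16 Theorem [18]; VuTuritsyn2017, §4.3 Theorem 1] -/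
theorem tendsto_relState_of_slabCertificate_shifted (hp : p.WellFormed) (hr : r ∉ p.gen)
    (hginj : Function.Injective gnode) (hgen : ∀ v, v ∈ p.gen ↔ ∃ j, gnode j = v)
    (hb : p.b = symmetrize (edgeWeight src tgt wt)) (hδeq : p.IsSyncEquilibrium δs)
    (Λ : SlabCertificate (p.relLurie r gnode src tgt wt δs)) {γ : Fin m → ℝ}
    (hsec : ∀ e ξ, |ξ - (p.relLurie r gnode src tgt wt δs).δs e| ≤ γ e →
      Λ.a e ≤ Real.cos ξ ∧ Real.cos ξ ≤ Λ.b e)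
    {c : ℝ} (hfr : ∀ x ∈ frontier ((p.relLurie r gnode src tgt wt δs).slab γ), c < Λ.V x)
    {X : ℝ → (Fin (k + 1) → ℝ) × (Fin (k + 1) → ℝ)}
    (hX : ∀ T : ℝ, ∀ t ∈ Icc 0 T, HasDerivWithinAt X (p.shifted.phaseField (X t)) (Icc 0 T) t)
    (h0 : ∀ e, |((X 0).1 (src e) - (X 0).1 (tgt e)) - (δs (src e) - δs (tgt e))| < γ e)
    (hc : Λ.V (relState r gnode δs (X 0)) ≤ c) :
    (∀ t, 0 ≤ t →
        (∀ e, |((X t).1 (src e) - (X t).1 (tgt e)) - (δs (src e) - δs (tgt e))| < γ e) ∧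
        Λ.V (relState r gnode δs (X t)) ≤ c) ∧
      Tendsto (fun t => relState r gnode δs (X t)) atTop (𝓝 0) :=
  have hp' : p.shifted.WellFormed := ⟨hp.M_pos, hp.M_eq_zero, hp.D_pos, hp.b_symm⟩
  have hP' : ∀ v, p.shifted.pe δs v = p.shifted.P0 v := fun v => by
    rw [shifted_pe, shifted_P0]; exact hδeq v
  tendsto_relState_of_slabCertificate (p := p.shifted) hp' hr hginj hgen hb hP' Λ hsec hfr hX h0 hc

/-- **The slab certificate for the structure-preserving model AS PRINTED** (`p.IsSolution δ`:
`Mᵥδ̈ᵥ + Dᵥδ̇ᵥ + fᵥ(δ) = P⁰ᵥ`, any `P⁰`, synchronous equilibrium `δ*` with frequency `ω₀ = ΣP⁰/ΣD`):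
for every solution whose initial listed line-angle deviations satisfy `|σ_e(0) − σ*_e| < γ_e` and whose
initial relative state `relState(δ(0), δ̇(0) − ω₀)` has `V ≤ c`: the deviations stay `< γ_e` for all
`t ≥ 0`, every angle difference `δᵥ(t) − δ_w(t) → δ*ᵥ − δ*_w`, and every generator speed
`δ̇ᵥ(t) → ω₀`. MODEL MV-3, CLASS = the certificate's well; nothing here says a grid is stable.
[cite: Pai1981, §2.16 Theorem [18] and §4.7; VuTuritsyn2017, §4.3 Theorem 1; Padiyar2013, §3.2 eq (3.2)] -/
theorem tendsto_of_isSolution_of_slabCertificate (hp : p.WellFormed) (hr : r ∉ p.gen)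
    (hginj : Function.Injective gnode) (hgen : ∀ v, v ∈ p.gen ↔ ∃ j, gnode j = v)
    (hb : p.b = symmetrize (edgeWeight src tgt wt)) (hδeq : p.IsSyncEquilibrium δs)
    (Λ : SlabCertificate (p.relLurie r gnode src tgt wt δs)) {γ : Fin m → ℝ}
    (hsec : ∀ e ξ, |ξ - (p.relLurie r gnode src tgt wt δs).δs e| ≤ γ e →
      Λ.a e ≤ Real.cos ξ ∧ Real.cos ξ ≤ Λ.b e)
    {c : ℝ} (hfr : ∀ x ∈ frontier ((p.relLurie r gnode src tgt wt δs).slab γ), c < Λ.V x)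
    {δ : ℝ → Fin (k + 1) → ℝ} (hδ : p.IsSolution δ)
    (h0 : ∀ e, |(δ 0 (src e) - δ 0 (tgt e)) - (δs (src e) - δs (tgt e))| < γ e)
    (hc : Λ.V (relState r gnode δs (δ 0, fun v => deriv (fun u => δ u v) 0 - p.syncFreq)) ≤ c) :
    (∀ t, 0 ≤ t → ∀ e, |(δ t (src e) - δ t (tgt e)) - (δs (src e) - δs (tgt e))| < γ e) ∧
      (∀ v w, Tendsto (fun t => δ t v - δ t w) atTop (𝓝 (δs v - δs w))) ∧
      ∀ v ∈ p.gen, Tendsto (fun t => deriv (fun u => δ u v) t) atTop (𝓝 p.syncFreq) := by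
  have hs := hδ.shift
  have hp' : p.shifted.WellFormed := ⟨hp.M_pos, hp.M_eq_zero, hp.D_pos, hp.b_symm⟩
  set X := p.shifted.toPhase (fun t i => δ t i - p.syncFreq * t) with hXdef
  have hX : ∀ T : ℝ, ∀ t ∈ Icc 0 T,
      HasDerivWithinAt X (p.shifted.phaseField (X t)) (Icc 0 T) t :=
    fun T t _ => (hs.hasDerivAt_toPhase hp' t).hasDerivWithinAt
  have hderiv : ∀ v t, deriv (fun s => δ s v - p.syncFreq * s) t
      = deriv (fun s => δ s v) t - p.syncFreq := by
    intro v t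
    have h1 := ((hδ.differentiable v) t).hasDerivAt
    have h2 : HasDerivAt (fun s : ℝ => p.syncFreq * s) p.syncFreq t := by
      simpa using (hasDerivAt_id t).const_mul p.syncFreq
    exact (h1.sub h2).deriv
  have hX1 : ∀ t v w, (X t).1 v - (X t).1 w = δ t v - δ t w := by
    intro t v w
    simp only [hXdef, toPhase_fst]
    ring
  have hX0 : relState r gnode δs (X 0)
      = relState r gnode δs (δ 0, fun v => deriv (fun u => δ u v) 0 - p.syncFreq) := by
    funext a
    rcases a with i | j
    · simp only [relState_inl, hX1]
    · have hjg : gnode j ∈ p.shifted.gen := (hgen _).2 ⟨j, rfl⟩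
      simp only [relState_inr, hXdef, toPhase_snd_of_mem hjg, hderiv]
  have h0' : ∀ e, |((X 0).1 (src e) - (X 0).1 (tgt e)) - (δs (src e) - δs (tgt e))| < γ e :=
    fun e => by rw [hX1]; exact h0 e
  have hc' : Λ.V (relState r gnode δs (X 0)) ≤ c := by rw [hX0]; exact hc
  obtain ⟨hstay, hlim⟩ := tendsto_relState_of_slabCertificate_shifted hp hr hginj hgen hb hδeq Λ
    hsec hfr hX h0' hc'
  obtain ⟨hdiff, hfreq⟩ := tendsto_of_tendsto_relState (p := p.shifted) (r := r) (δs := δs) hgen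
    hlim
  refine ⟨fun t ht e => ?_, fun v w => ?_, fun v hv => ?_⟩
  · have := (hstay t ht).1 e
    rwa [hX1] at this
  · have h := hdiff v w
    simp only [hX1] at h
    exact h
  · have hv' : v ∈ p.shifted.gen := hv
    have h := hfreq v hv'
    have e1 : (fun t => (X t).2 v) = fun t => deriv (fun u => δ u v) t - p.syncFreq := by
      funext t
      simp only [hXdef, toPhase_snd_of_mem hv', hderiv]
    rw [e1] at h
    have h' := h.add_const p.syncFreq
    simpa using h'

end Params

end Summit.Ventures.GridStability.Models.StructurePreserving

end
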